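import Mathlib
import HarnessLib
import Summits.HubbardSuperconductivity.HubbardSuperconductivity.Theorems.KLProgrammeKLRegimeTwoCutoffScaleZeroSizes
import Summits.HubbardSuperconductivity.HubbardSuperconductivity.Theorems.KLProgrammeKLRegimeEngineScaleZeroThetaPackage

/-!
# Route `KLProgramme` — ENGINE child `KLRegimeEngineV16` (stmt-HubbardSuperconductivity-20236), `stub_twoLeg_scale0`, (E3f-AT)₀ cutoff leg:
# the sub-dyadic step with ALL sizes discharged (cell gate-hubbard-kl, seat hubbard-kl-k3c4-p2 g6; route (C))

Sequel of `…TwoCutoffScaleZeroSizes`.  With `U ≤ 2^{-128}/Rsq⁴` (implied by `U ≤ klEngU₀4 P R c`), `μ ∈ klWindowC`, `klScaleZeroA0 ≤ 2^{43}`,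
`klKappaFrameC R ≤ 2^{13}(Gfr0+1)(Gfr2+1) ≤ 2^{15}Rsq²` (`…EngineScaleZeroThetaPackage`) and `M ≥ 2^{10}β²(L+1)²`, both smallness conditions of
`abs_klLocalPart_zero_twoCutoff_sub_le_sizes` hold and its right side is `≤ β/(2^{60}√M)`:
**`abs_klLocalPart_zero_twoCutoff_sub_le_of_small`**.  Chaining and the `hcut` shape: `…TwoCutoffScaleZeroLeg`.  Proof only; no definitions.
-/

noncomputable section

namespace Summit.HubbardSuperconductivity.HubbardSuperconductivity.Theorems.TwoVolumeDefect

set_option linter.dupNamespace false -- summit = problem name (single-conjunct summit), D-0017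

open Finset Literature.MathematicalPhysics.QuantumLattice Literature.Probability.LatticeModels GrassmannAlgebra
open Summit.HubbardSuperconductivity.HubbardSuperconductivity.Theorems.KLRegimeSplit
open Summit.HubbardSuperconductivity.HubbardSuperconductivity.Theorems.KLProgrammeLegKernels
open Summit.HubbardSuperconductivity.HubbardSuperconductivity.Theorems.EngineV8

variable {L M M'' : ℕ} [NeZero L]

/-! ## §1 Numeric constants -/

/-- `110 < κ_C = √(2(8+6047)) < 111`. -/
theorem kappaC_bounds : 110 < Real.sqrt (2 * (8 + Real.sqrt 6047 ^ 2)) ∧ Real.sqrt (2 * (8 + Real.sqrt 6047 ^ 2)) < 111 := by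
  rw [Real.sq_sqrt (by norm_num), show (2 : ℝ) * (8 + 6047) = 12110 by norm_num]
  constructor
  · rw [show (110 : ℝ) = Real.sqrt (110 ^ 2) by rw [Real.sqrt_sq (by norm_num)]]
    exact Real.sqrt_lt_sqrt (by norm_num) (by norm_num)
  · rw [show (111 : ℝ) = Real.sqrt (111 ^ 2) by rw [Real.sqrt_sq (by norm_num)]]
    exact Real.sqrt_lt_sqrt (by norm_num) (by norm_num)

/-- `e < 2.72` and `e² < 7.4`. -/
theorem exp_bounds : Real.exp 1 < 2.72 ∧ Real.exp 2 < 7.4 := by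
  have h1 : Real.exp 1 < 2.7182818286 := Real.exp_one_lt_d9
  refine ⟨by linarith, ?_⟩
  rw [show (2 : ℝ) = 1 + 1 by norm_num, Real.exp_add]
  nlinarith [Real.exp_pos 1]

/-! ## §2 The sub-dyadic step under the small-coupling / large-cutoff conditions -/

set_option maxHeartbeats 8000000 in
/-- **THE SUB-DYADIC STEP OF THE CUTOFF LEG, sizes discharged**: for an admissible frame (`FrameOK R U Nsc μ K`, `R.WF`),
`0 < U ≤ 2^{-128}/Rsq⁴`, `μ ∈ klWindowC`, `klBetaMin ≤ β ≤ L`, and a sub-dyadic pair `M ≤ M″ ≤ 2M` with `2^{10}β²(L+1)² ≤ M`: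
`|klLocalPart L M … 0 θ − klLocalPart L M″ … 0 θ| ≤ β/(2^{60}·√M)`. -/
theorem abs_klLocalPart_zero_twoCutoff_sub_le_of_small [NeZero M] [NeZero M''] {R : RenConsts} (hR : R.WF) {U : ℝ} (hU : 0 < U)
    (hUs : U ≤ 1 / ((2 : ℝ) ^ 128 * klEngRsq R ^ 4)) {Nsc : ℕ} {μ : ℝ} (hμ : μ ∈ klWindowC) {K : TrigPolyC4v}
    (hK : FrameOK R U Nsc μ K) {β : ℝ} (hβ : klBetaMin ≤ β) (hβL : β ≤ L)
    (hMlow : (2 : ℝ) ^ 10 * β ^ 2 * ((L : ℝ) + 1) ^ 2 ≤ M) (h : M ≤ M'') (hM2 : M'' ≤ 2 * M) (θ : ℝ) :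
    |klLocalPart L M β U μ K 0 θ - klLocalPart L M'' β U μ K 0 θ| ≤ β / ((2 : ℝ) ^ 60 * Real.sqrt M) := by
  haveI : NeZero (2 * (2 * M'')) := ⟨by have := NeZero.ne M''; omega⟩
  have hβ128 : (128 : ℝ) ≤ β := by simpa [klBetaMin] using hβ
  have hβpos : 0 < β := by linarith
  have hβ1 : (1 : ℝ) ≤ β := by linarith
  have hL1 : (1 : ℝ) ≤ L := by exact_mod_cast Nat.one_le_iff_ne_zero.2 (NeZero.ne L)
  have hRsq1 : 1 ≤ klEngRsq R := one_le_klEngRsq R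
  have hU128 : U ≤ 1 / (2 : ℝ) ^ 128 := hUs.trans (by
    refine one_div_le_one_div_of_le (by positivity) ?_
    have : (1 : ℝ) ≤ klEngRsq R ^ 4 := one_le_pow₀ hRsq1
    have h2 : (0 : ℝ) < (2 : ℝ) ^ 128 := by positivity
    calc (2 : ℝ) ^ 128 = (2 : ℝ) ^ 128 * 1 := (mul_one _).symm
      _ ≤ (2 : ℝ) ^ 128 * klEngRsq R ^ 4 := mul_le_mul_of_nonneg_left this h2.le)
  have hU1 : U ≤ 1 := hU128.trans (by norm_num)
  have hUabs : |U| = U := abs_of_pos hU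
  have hG := hR.2.2
  have hμabs : |μ| ≤ 1.05 := by
    rcases hμ with ⟨h1, h2⟩
    rw [abs_le]; constructor <;> linarith
  have hMr : (0 : ℝ) < M := by
    have : (0 : ℝ) < (2 : ℝ) ^ 10 * β ^ 2 * ((L : ℝ) + 1) ^ 2 := by positivity
    linarith
  have hM1 : 1 ≤ M := by
    have h1 : (1 : ℝ) ≤ β ^ 2 := one_le_pow₀ hβ1
    have h2 : (1 : ℝ) ≤ ((L : ℝ) + 1) ^ 2 := one_le_pow₀ (by linarith)
    have h3 : (1 : ℝ) ≤ (2 : ℝ) ^ 10 * β ^ 2 * ((L : ℝ) + 1) ^ 2 := by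
      have h12 := mul_le_mul h1 h2 (by norm_num) (by positivity)
      rw [one_mul] at h12
      have : β ^ 2 * ((L : ℝ) + 1) ^ 2 ≤ (2 : ℝ) ^ 10 * (β ^ 2 * ((L : ℝ) + 1) ^ 2) :=
        le_mul_of_one_le_left (by positivity) (by norm_num)
      linarith
    have : (1 : ℝ) ≤ M := h3.trans hMlow
    exact_mod_cast this
  have hMM'' : (M : ℝ) ≤ M'' := by exact_mod_cast h
  have hM''2 : (M'' : ℝ) ≤ 2 * M := by exact_mod_cast hM2
  have hsqM : 32 * β * ((L : ℝ) + 1) ≤ Real.sqrt M := by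
    rw [show 32 * β * ((L : ℝ) + 1) = Real.sqrt ((32 * β * ((L : ℝ) + 1)) ^ 2) by rw [Real.sqrt_sq (by positivity)]]
    refine Real.sqrt_le_sqrt ?_
    rw [show (32 * β * ((L : ℝ) + 1)) ^ 2 = (2 : ℝ) ^ 10 * β ^ 2 * ((L : ℝ) + 1) ^ 2 by ring]
    exact hMlow
  have hsqM0 : 0 < Real.sqrt M := Real.sqrt_pos.2 hMr
  have h64 : 64 * β ≤ Real.sqrt M := by
    have : 32 * β * 2 ≤ 32 * β * ((L : ℝ) + 1) := mul_le_mul_of_nonneg_left (by linarith) (by positivity)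
    linarith
  have h8192 : (8192 : ℝ) ≤ Real.sqrt M := by linarith
  have hsqMM : Real.sqrt M * Real.sqrt M = M := Real.mul_self_sqrt hMr.le
  have hβ3 : β ^ 3 ≤ (M'' : ℝ) := by
    have hβLL : β ≤ (2 : ℝ) ^ 10 * ((L : ℝ) + 1) ^ 2 := by
      have h1 : (L : ℝ) ≤ ((L : ℝ) + 1) ^ 2 := by nlinarith [hL1]
      have h2 : ((L : ℝ) + 1) ^ 2 ≤ (2 : ℝ) ^ 10 * ((L : ℝ) + 1) ^ 2 := le_mul_of_one_le_left (by positivity) (by norm_num)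
      linarith
    have : β ^ 3 ≤ (2 : ℝ) ^ 10 * β ^ 2 * ((L : ℝ) + 1) ^ 2 := by
      calc β ^ 3 = β ^ 2 * β := by ring
        _ ≤ β ^ 2 * ((2 : ℝ) ^ 10 * ((L : ℝ) + 1) ^ 2) := mul_le_mul_of_nonneg_left hβLL (sq_nonneg β)
        _ = _ := by ring
    linarith
  have hfloor : klE0 ≤ Real.pi * (2 * M + 1) / β := by
    rw [klE0, le_div_iff₀ hβpos]
    have hπ : (3 : ℝ) ≤ Real.pi := by linarith [Real.pi_gt_three]
    have hsqle : Real.sqrt M ≤ M := by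
      have h1 : (1 : ℝ) ≤ Real.sqrt M := by linarith
      have := mul_le_mul_of_nonneg_left h1 hsqM0.le
      rw [mul_one, hsqMM] at this
      exact this
    have hMβ : β ≤ (M : ℝ) := by linarith
    have : 3 * (2 * (M : ℝ) + 1) ≤ Real.pi * (2 * M + 1) := mul_le_mul_of_nonneg_right hπ (by positivity)
    linarith
  set N : ℕ := 2 * (2 * M'') with hNdef
  have hNr : (N : ℝ) = 4 * M'' := by rw [hNdef]; push_cast; ring
  have hN0 : (0 : ℝ) < N := by rw [hNr]; linarith
  set cK : ℝ := klKappaFrameC R * |U| with hcK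
  set c : ℝ := 4 + |μ| + cK with hc
  set n2 : ℝ := |β| / (N : ℝ) * cK with hn2
  set n4 : ℝ := |U| * |β| / (N : ℝ) with hn4
  set tE : ℝ := c * β / (2 * Real.pi ^ 2 * M) with htE
  set aS : ℝ := (N : ℝ) / (Real.pi * Real.sqrt (2 * M)) + (N : ℝ) * β * c / (2 * Real.pi ^ 2 * M) +
    (N : ℝ) * (L : ℝ) ^ 2 * c ^ 2 * β ^ 2 / (2 * Real.pi ^ 3 * M * (2 * M + 1)) with haS
  set aC : ℝ := (N : ℝ) / β * klScaleZeroA0 with haC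
  set κC : ℝ := Real.sqrt (2 * (8 + Real.sqrt 6047 ^ 2)) with hκC
  set ρS : ℝ := 4 * Real.exp 2 * κC with hρS
  set VS : ℝ := (Real.exp 2 * (1 + ρS)) ^ 2 * n2 + (Real.exp 2 * (1 + ρS)) ^ 4 * n4 with hVS
  set θS : ℝ := Real.exp 1 * aS * VS with hθS
  set VC : ℝ := (Real.exp 2 * (κC + κC)) ^ 2 * n2 + (Real.exp 2 * (κC + κC)) ^ 4 * n4 with hVC
  set VD : ℝ := (Real.exp 2 * (κC + κC)) ^ 2 * (6 * tE * n4) + (Real.exp 1 * VS * θS / (1 - θS)) / 3 with hVD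
  obtain ⟨hκlo, hκhi⟩ := kappaC_bounds
  rw [← hκC] at hκlo hκhi
  obtain ⟨he1, he2⟩ := exp_bounds
  have he1p : 0 < Real.exp 1 := Real.exp_pos 1
  have he2p : 0 < Real.exp 2 := Real.exp_pos 2
  have hcK0 : 0 ≤ cK := by rw [hcK]; exact mul_nonneg (klKappaFrameC_pos (hG 0)).le (abs_nonneg U)
  have hcKle : cK ≤ 1 / (2 : ℝ) ^ 113 := by
    have hKC := klKappaFrameC_le (hG 0) (hG 2)
    have hG0 : R.Gfr 0 ≤ klEngRsq R := gfr_le_klEngRsq R (by norm_num)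
    have hG2 : R.Gfr 2 ≤ klEngRsq R := gfr_le_klEngRsq R (by norm_num)
    have hb : (R.Gfr 0 + 1) * (R.Gfr 2 + 1) ≤ 4 * klEngRsq R ^ 2 := by
      have h1 : R.Gfr 0 + 1 ≤ 2 * klEngRsq R := by linarith
      have h2 : R.Gfr 2 + 1 ≤ 2 * klEngRsq R := by linarith
      have := mul_le_mul h1 h2 (by linarith [hG 2]) (by positivity)
      linarith
    rw [hcK, hUabs]
    have hU' : U * ((2 : ℝ) ^ 128 * klEngRsq R ^ 4) ≤ 1 := (le_div_iff₀ (by positivity)).1 hUs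
    have hR24 : klEngRsq R ^ 2 ≤ klEngRsq R ^ 4 := pow_le_pow_right₀ hRsq1 (by norm_num)
    have hKU : klKappaFrameC R * U ≤ (2 : ℝ) ^ 15 * klEngRsq R ^ 2 * U :=
      mul_le_mul_of_nonneg_right (hKC.trans (by linarith [mul_le_mul_of_nonneg_left hb (show (0:ℝ) ≤ (2:ℝ) ^ 13 by positivity)])) hU.le
    refine hKU.trans ?_
    rw [le_div_iff₀ (by positivity)]
    have h1 := mul_le_mul_of_nonneg_left hR24 (show (0 : ℝ) ≤ (2 : ℝ) ^ 128 * U by positivity)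
    have h2 : (2 : ℝ) ^ 15 * klEngRsq R ^ 2 * U * (2 : ℝ) ^ 113 = (2 : ℝ) ^ 128 * U * klEngRsq R ^ 2 := by ring
    have h3 : U * ((2 : ℝ) ^ 128 * klEngRsq R ^ 4) = (2 : ℝ) ^ 128 * U * klEngRsq R ^ 4 := by ring
    linarith
  have hcK1 : cK ≤ 1 := hcKle.trans (by norm_num)
  have hc7 : c ≤ 7 := by rw [hc]; linarith
  have hc0 : 0 ≤ c := by rw [hc]; positivity
  have hn2' : n2 = β / N * cK := by rw [hn2, abs_of_pos hβpos]
  have hn4' : n4 = β / N * U := by rw [hn4, hUabs, abs_of_pos hβpos]; ring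
  have hβN : 0 < β / N := by positivity
  have hρSle : ρS ≤ 3286 := by
    rw [hρS]
    have := mul_le_mul he2.le hκhi.le (by positivity) (by norm_num)
    linarith
  have hρS0 : 0 ≤ ρS := by rw [hρS]; positivity
  have hg1 : Real.exp 2 * (1 + ρS) ≤ (2 : ℝ) ^ 15 :=
    (mul_le_mul he2.le (show 1 + ρS ≤ 3287 by linarith) (by positivity) (by norm_num)).trans (by norm_num)
  have hg2 : Real.exp 2 * (κC + κC) ≤ (2 : ℝ) ^ 11 :=
    (mul_le_mul he2.le (show κC + κC ≤ 222 by linarith) (by positivity) (by norm_num)).trans (by norm_num)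
  have hg1p : 0 ≤ Real.exp 2 * (1 + ρS) := by positivity
  have hg2p : 0 ≤ Real.exp 2 * (κC + κC) := by positivity
  have hVSle : VS ≤ β / N * (1 / (2 : ℝ) ^ 67) := by
    have h30 : (Real.exp 2 * (1 + ρS)) ^ 2 ≤ (2 : ℝ) ^ 30 := (pow_le_pow_left₀ hg1p hg1 2).trans (by norm_num)
    have h60 : (Real.exp 2 * (1 + ρS)) ^ 4 ≤ (2 : ℝ) ^ 60 := (pow_le_pow_left₀ hg1p hg1 4).trans (by norm_num)
    rw [hVS, hn2', hn4']
    have : (2 : ℝ) ^ 30 * cK + (2 : ℝ) ^ 60 * U ≤ 1 / (2 : ℝ) ^ 67 := by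
      have h1 : (2 : ℝ) ^ 30 * cK ≤ (2 : ℝ) ^ 30 * (1 / (2 : ℝ) ^ 113) := mul_le_mul_of_nonneg_left hcKle (by positivity)
      have h2 : (2 : ℝ) ^ 60 * U ≤ (2 : ℝ) ^ 60 * (1 / (2 : ℝ) ^ 128) := mul_le_mul_of_nonneg_left hU128 (by positivity)
      have h3 : (2 : ℝ) ^ 30 * (1 / (2 : ℝ) ^ 113) + (2 : ℝ) ^ 60 * (1 / (2 : ℝ) ^ 128) ≤ 1 / (2 : ℝ) ^ 67 := by norm_num
      linarith
    calc (Real.exp 2 * (1 + ρS)) ^ 2 * (β / N * cK) + (Real.exp 2 * (1 + ρS)) ^ 4 * (β / N * U)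
        = β / N * ((Real.exp 2 * (1 + ρS)) ^ 2 * cK + (Real.exp 2 * (1 + ρS)) ^ 4 * U) := by ring
      _ ≤ β / N * ((2 : ℝ) ^ 30 * cK + (2 : ℝ) ^ 60 * U) := by gcongr
      _ ≤ β / N * (1 / (2 : ℝ) ^ 67) := by gcongr
  have hVCle : VC ≤ β / N * (1 / (2 : ℝ) ^ 83) := by
    have h22 : (Real.exp 2 * (κC + κC)) ^ 2 ≤ (2 : ℝ) ^ 22 := (pow_le_pow_left₀ hg2p hg2 2).trans (by norm_num)
    have h44 : (Real.exp 2 * (κC + κC)) ^ 4 ≤ (2 : ℝ) ^ 44 := (pow_le_pow_left₀ hg2p hg2 4).trans (by norm_num)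
    rw [hVC, hn2', hn4']
    have : (2 : ℝ) ^ 22 * cK + (2 : ℝ) ^ 44 * U ≤ 1 / (2 : ℝ) ^ 83 := by
      have h1 : (2 : ℝ) ^ 22 * cK ≤ (2 : ℝ) ^ 22 * (1 / (2 : ℝ) ^ 113) := mul_le_mul_of_nonneg_left hcKle (by positivity)
      have h2 : (2 : ℝ) ^ 44 * U ≤ (2 : ℝ) ^ 44 * (1 / (2 : ℝ) ^ 128) := mul_le_mul_of_nonneg_left hU128 (by positivity)
      have h3 : (2 : ℝ) ^ 22 * (1 / (2 : ℝ) ^ 113) + (2 : ℝ) ^ 44 * (1 / (2 : ℝ) ^ 128) ≤ 1 / (2 : ℝ) ^ 83 := by norm_num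
      linarith
    calc (Real.exp 2 * (κC + κC)) ^ 2 * (β / N * cK) + (Real.exp 2 * (κC + κC)) ^ 4 * (β / N * U)
        = β / N * ((Real.exp 2 * (κC + κC)) ^ 2 * cK + (Real.exp 2 * (κC + κC)) ^ 4 * U) := by ring
      _ ≤ β / N * ((2 : ℝ) ^ 22 * cK + (2 : ℝ) ^ 44 * U) := by gcongr
      _ ≤ β / N * (1 / (2 : ℝ) ^ 83) := by gcongr
  have hVS0 : 0 ≤ VS := by rw [hVS]; positivity
  have hVC0 : 0 ≤ VC := by rw [hVC]; positivity
  have hsq2M : Real.sqrt 2 * Real.sqrt M = Real.sqrt (2 * M) := by rw [← Real.sqrt_mul (by norm_num)]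
  have hsq2 : (1.4 : ℝ) ≤ Real.sqrt 2 := by
    rw [show (1.4 : ℝ) = Real.sqrt (1.4 ^ 2) by rw [Real.sqrt_sq (by norm_num)]]
    exact Real.sqrt_le_sqrt (by norm_num)
  have hπ3 : (3 : ℝ) ≤ Real.pi := by linarith [Real.pi_gt_three]
  have hπ2 : (9 : ℝ) ≤ Real.pi ^ 2 := by
    have := pow_le_pow_left₀ (by norm_num) hπ3 2; norm_num at this; exact this
  have hπ3' : (27 : ℝ) ≤ Real.pi ^ 3 := by
    have := pow_le_pow_left₀ (by norm_num) hπ3 3; norm_num at this; exact this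
  have hq0 : 0 ≤ β / Real.sqrt M := by positivity
  have haS_w : β / N * aS ≤ β / (3 * Real.sqrt M) := by
    have hT1 : β / N * ((N : ℝ) / (Real.pi * Real.sqrt (2 * M))) = β / (Real.pi * Real.sqrt 2 * Real.sqrt M) := by
      rw [← hsq2M]; field_simp
    have h42 : 4 * Real.sqrt M ≤ Real.pi * Real.sqrt 2 * Real.sqrt M := by
      have : (4 : ℝ) ≤ Real.pi * Real.sqrt 2 := by
        have := mul_le_mul hπ3 hsq2 (by norm_num) Real.pi_pos.le; linarith
      exact mul_le_mul_of_nonneg_right this hsqM0.le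
    have hT1le : β / (Real.pi * Real.sqrt 2 * Real.sqrt M) ≤ 1 / 4 * (β / Real.sqrt M) := by
      rw [show 1 / 4 * (β / Real.sqrt M) = β / (4 * Real.sqrt M) by field_simp]
      exact div_le_div_of_nonneg_left hβpos.le (by positivity) h42
    have hT2 : β / N * ((N : ℝ) * β * c / (2 * Real.pi ^ 2 * M)) = β ^ 2 * c / (2 * Real.pi ^ 2 * M) := by field_simp
    have hT2le : β ^ 2 * c / (2 * Real.pi ^ 2 * M) ≤ 1 / 100 * (β / Real.sqrt M) := by
      have hden : 18 * (M : ℝ) ≤ 2 * Real.pi ^ 2 * M := by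
        have := mul_le_mul_of_nonneg_right hπ2 hMr.le; linarith
      calc β ^ 2 * c / (2 * Real.pi ^ 2 * M) ≤ β ^ 2 * c / (18 * M) := div_le_div_of_nonneg_left (by positivity) (by positivity) hden
        _ = (β * c / (18 * Real.sqrt M)) * (β / Real.sqrt M) := by
            rw [div_mul_div_comm, show 18 * Real.sqrt M * Real.sqrt M = 18 * M by rw [mul_assoc, hsqMM]]; ring
        _ ≤ 1 / 100 * (β / Real.sqrt M) := by
            refine mul_le_mul_of_nonneg_right ?_ hq0
            rw [div_le_div_iff₀ (by positivity) (by norm_num)]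
            have : β * c ≤ 7 * β := by rw [mul_comm]; exact mul_le_mul_of_nonneg_right hc7 hβpos.le
            linarith
    have hT3 : β / N * ((N : ℝ) * (L : ℝ) ^ 2 * c ^ 2 * β ^ 2 / (2 * Real.pi ^ 3 * M * (2 * M + 1))) =
        β ^ 3 * (L : ℝ) ^ 2 * c ^ 2 / (2 * Real.pi ^ 3 * M * (2 * M + 1)) := by field_simp
    have hc2 : c ^ 2 ≤ 49 := by
      have := pow_le_pow_left₀ hc0 hc7 2; norm_num at this; exact this
    have hT3le : β ^ 3 * (L : ℝ) ^ 2 * c ^ 2 / (2 * Real.pi ^ 3 * M * (2 * M + 1)) ≤ 1 / 100 * (β / Real.sqrt M) := by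
      have hL2 : (L : ℝ) ^ 2 ≤ ((L : ℝ) + 1) ^ 2 := pow_le_pow_left₀ (by linarith) (by linarith) 2
      have hnum : β ^ 3 * (L : ℝ) ^ 2 * c ^ 2 ≤ β * (49 / (2 : ℝ) ^ 10) * M := by
        have h1 : β ^ 2 * (L : ℝ) ^ 2 * c ^ 2 ≤ β ^ 2 * ((L : ℝ) + 1) ^ 2 * 49 := by gcongr
        have h2 : β ^ 2 * ((L : ℝ) + 1) ^ 2 ≤ (M : ℝ) / (2 : ℝ) ^ 10 := by rw [le_div_iff₀ (by positivity)]; linarith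
        calc β ^ 3 * (L : ℝ) ^ 2 * c ^ 2 = β * (β ^ 2 * (L : ℝ) ^ 2 * c ^ 2) := by ring
          _ ≤ β * (β ^ 2 * ((L : ℝ) + 1) ^ 2 * 49) := mul_le_mul_of_nonneg_left h1 hβpos.le
          _ ≤ β * ((M : ℝ) / (2 : ℝ) ^ 10 * 49) := by gcongr
          _ = β * (49 / (2 : ℝ) ^ 10) * M := by ring
      have hden : 54 * (M : ℝ) * M ≤ 2 * Real.pi ^ 3 * M * (2 * M + 1) := by
        have h1 : 54 * (M : ℝ) * M ≤ 2 * Real.pi ^ 3 * M * M := by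
          have := mul_le_mul_of_nonneg_right hπ3' (show (0:ℝ) ≤ (M:ℝ) * M by positivity); linarith
        have h2 : 2 * Real.pi ^ 3 * (M : ℝ) * M ≤ 2 * Real.pi ^ 3 * M * (2 * M + 1) :=
          mul_le_mul_of_nonneg_left (by linarith) (by positivity)
        linarith
      calc β ^ 3 * (L : ℝ) ^ 2 * c ^ 2 / (2 * Real.pi ^ 3 * M * (2 * M + 1))
          ≤ β * (49 / (2 : ℝ) ^ 10) * M / (54 * M * M) := div_le_div₀ (by positivity) hnum (by positivity) hden
        _ = (49 / ((2 : ℝ) ^ 10 * 54 * Real.sqrt M)) * (β / Real.sqrt M) := by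
            rw [div_mul_div_comm, show (2 : ℝ) ^ 10 * 54 * Real.sqrt M * Real.sqrt M = (2 : ℝ) ^ 10 * 54 * M by
              rw [mul_assoc, hsqMM]]
            field_simp
        _ ≤ 1 / 100 * (β / Real.sqrt M) := by
            refine mul_le_mul_of_nonneg_right ?_ hq0
            rw [div_le_div_iff₀ (by positivity) (by norm_num)]
            linarith
    rw [haS, mul_add, mul_add, hT1, hT2, hT3]
    have h3 : (1 / 4 + 1 / 100 + 1 / 100) * (β / Real.sqrt M) ≤ β / (3 * Real.sqrt M) := by
      rw [show β / (3 * Real.sqrt M) = 1 / 3 * (β / Real.sqrt M) by field_simp]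
      exact mul_le_mul_of_nonneg_right (by norm_num) hq0
    linarith
  have haS_small : β / N * aS ≤ 1 / 90 := by
    refine haS_w.trans ?_
    rw [div_le_div_iff₀ (by positivity) (by norm_num)]
    linarith
  have haS0 : 0 ≤ aS := by rw [haS]; positivity
  have hθSle : θS ≤ 1 / (2 : ℝ) ^ 70 := by
    rw [hθS]
    calc Real.exp 1 * aS * VS ≤ Real.exp 1 * aS * (β / N * (1 / (2 : ℝ) ^ 67)) := by gcongr
      _ = Real.exp 1 * (β / N * aS) * (1 / (2 : ℝ) ^ 67) := by ring
      _ ≤ 2.72 * (1 / 90) * (1 / (2 : ℝ) ^ 67) := by gcongr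
      _ ≤ 1 / (2 : ℝ) ^ 70 := by norm_num
  have hθS0 : 0 ≤ θS := by rw [hθS]; positivity
  have hθShalf : θS ≤ 1 / 2 := hθSle.trans (by norm_num)
  have htE0 : 0 ≤ tE := by rw [htE]; positivity
  have htEle : tE ≤ 1 / 2240 * (β / Real.sqrt M) := by
    have hden : 18 * (M : ℝ) ≤ 2 * Real.pi ^ 2 * M := by
      have := mul_le_mul_of_nonneg_right hπ2 hMr.le; linarith
    rw [htE]
    calc c * β / (2 * Real.pi ^ 2 * M) ≤ c * β / (18 * M) := div_le_div_of_nonneg_left (by positivity) (by positivity) hden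
      _ = (c / (18 * Real.sqrt M)) * (β / Real.sqrt M) := by
          rw [div_mul_div_comm, show 18 * Real.sqrt M * Real.sqrt M = 18 * M by rw [mul_assoc, hsqMM]]
      _ ≤ 1 / 2240 * (β / Real.sqrt M) := by
          refine mul_le_mul_of_nonneg_right ?_ hq0
          rw [div_le_div_iff₀ (by positivity) (by norm_num)]
          linarith
  have hVDle : VD ≤ β / N * (β / Real.sqrt M * (1 / (2 : ℝ) ^ 100)) := by
    have h22 : (Real.exp 2 * (κC + κC)) ^ 2 ≤ (2 : ℝ) ^ 22 := (pow_le_pow_left₀ hg2p hg2 2).trans (by norm_num)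
    have hA : (Real.exp 2 * (κC + κC)) ^ 2 * (6 * tE * n4) ≤ β / N * (β / Real.sqrt M * (1 / (2 : ℝ) ^ 101)) := by
      rw [hn4']
      calc (Real.exp 2 * (κC + κC)) ^ 2 * (6 * tE * (β / N * U))
          = β / N * ((Real.exp 2 * (κC + κC)) ^ 2 * 6 * tE * U) := by ring
        _ ≤ β / N * ((2 : ℝ) ^ 22 * 6 * (1 / 2240 * (β / Real.sqrt M)) * (1 / (2 : ℝ) ^ 128)) := by gcongr
        _ = β / N * (β / Real.sqrt M * ((2 : ℝ) ^ 22 * 6 / (2240 * (2 : ℝ) ^ 128))) := by ring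
        _ ≤ β / N * (β / Real.sqrt M * (1 / (2 : ℝ) ^ 101)) :=
            mul_le_mul_of_nonneg_left (mul_le_mul_of_nonneg_left (by norm_num) hq0) hβN.le
    have hB : Real.exp 1 * VS * θS / (1 - θS) / 3 ≤ β / N * (β / Real.sqrt M * (1 / (2 : ℝ) ^ 101)) := by
      have h1θ : 1 / 2 ≤ 1 - θS := by linarith
      rw [div_div, div_le_iff₀ (by linarith)]
      have hθS' : θS ≤ 2.72 * (β / (3 * Real.sqrt M)) * (1 / (2 : ℝ) ^ 67) := by
        rw [hθS]
        calc Real.exp 1 * aS * VS ≤ Real.exp 1 * aS * (β / N * (1 / (2 : ℝ) ^ 67)) := by gcongr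
          _ = Real.exp 1 * (β / N * aS) * (1 / (2 : ℝ) ^ 67) := by ring
          _ ≤ 2.72 * (β / (3 * Real.sqrt M)) * (1 / (2 : ℝ) ^ 67) := by gcongr
      have hβ3' : 0 ≤ β / (3 * Real.sqrt M) := by positivity
      calc Real.exp 1 * VS * θS
          ≤ 2.72 * (β / N * (1 / (2 : ℝ) ^ 67)) * (2.72 * (β / (3 * Real.sqrt M)) * (1 / (2 : ℝ) ^ 67)) :=
            mul_le_mul (mul_le_mul he1.le hVSle hVS0 (by norm_num)) hθS' hθS0 (by positivity)
        _ = β / N * (β / Real.sqrt M * (1 / (2 : ℝ) ^ 101)) * (2.72 * 2.72 * (2 : ℝ) ^ 101 / (3 * (2 : ℝ) ^ 134)) := by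
            ring
        _ ≤ β / N * (β / Real.sqrt M * (1 / (2 : ℝ) ^ 101)) * ((1 - θS) * 3) := by
            refine mul_le_mul_of_nonneg_left ?_ (by positivity)
            have : (2.72 * 2.72 * (2 : ℝ) ^ 101 / (3 * (2 : ℝ) ^ 134)) ≤ 1 := by norm_num
            linarith
    rw [hVD]
    have : β / N * (β / Real.sqrt M * (1 / (2 : ℝ) ^ 101)) + β / N * (β / Real.sqrt M * (1 / (2 : ℝ) ^ 101)) =
        β / N * (β / Real.sqrt M * (1 / (2 : ℝ) ^ 100)) := by ring
    linarith
  have hVD0 : 0 ≤ VD := by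
    rw [hVD]
    have h1θ : 0 < 1 - θS := by linarith
    positivity
  have hA0 := klScaleZeroA0_le_two_pow
  have hA0p := klScaleZeroA0_pos
  have hκ2 : (12100 : ℝ) ≤ κC ^ 2 := by
    have := pow_le_pow_left₀ (by norm_num) hκlo.le 2; norm_num at this; exact this
  have hβsq : β / Real.sqrt M ≤ 1 := by rw [div_le_one hsqM0]; linarith
  have hθC : Real.exp 1 * (aC + aS) * (VC + VD) / κC ^ 2 ≤ 1 / 2 := by
    have hsum1 : β / N * (aC + aS) ≤ (2 : ℝ) ^ 43 + 1 := by
      rw [mul_add]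
      have : β / N * aC = klScaleZeroA0 := by rw [haC]; field_simp
      rw [this]
      linarith [haS_small]
    have hsum2 : VC + VD ≤ β / N * (1 / (2 : ℝ) ^ 82) := by
      have : β / N * (β / Real.sqrt M * (1 / (2 : ℝ) ^ 100)) ≤ β / N * (1 / (2 : ℝ) ^ 100) := by
        refine mul_le_mul_of_nonneg_left ?_ hβN.le
        calc β / Real.sqrt M * (1 / (2 : ℝ) ^ 100) ≤ 1 * (1 / (2 : ℝ) ^ 100) := by gcongr
          _ = _ := one_mul _
      have h83 : β / N * (1 / (2 : ℝ) ^ 83) + β / N * (1 / (2 : ℝ) ^ 100) ≤ β / N * (1 / (2 : ℝ) ^ 82) := by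
        rw [← mul_add]; exact mul_le_mul_of_nonneg_left (by norm_num) hβN.le
      linarith [hVCle, hVDle]
    have hq : (VC + VD) / (β / N) ≤ 1 / (2 : ℝ) ^ 82 := by rw [div_le_iff₀ hβN]; linarith
    have hq0' : 0 ≤ (VC + VD) / (β / N) := by positivity
    have hprod : (aC + aS) * (VC + VD) ≤ ((2 : ℝ) ^ 43 + 1) * (1 / (2 : ℝ) ^ 82) := by
      have heq : (aC + aS) * (VC + VD) = (β / N * (aC + aS)) * ((VC + VD) / (β / N)) := by
        field_simp
      rw [heq]
      exact mul_le_mul hsum1 hq hq0' (by positivity)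
    calc Real.exp 1 * (aC + aS) * (VC + VD) / κC ^ 2
        = Real.exp 1 * ((aC + aS) * (VC + VD)) / κC ^ 2 := by ring
      _ ≤ 2.72 * (((2 : ℝ) ^ 43 + 1) * (1 / (2 : ℝ) ^ 82)) / 12100 := by
          refine div_le_div₀ (by positivity) ?_ (by norm_num) hκ2
          exact mul_le_mul he1.le hprod (by rw [haC]; positivity) (by norm_num)
      _ ≤ 1 / 2 := by norm_num
  have hmain := abs_klLocalPart_zero_twoCutoff_sub_le_sizes (L := L) (M := M) (M'' := M'') hR hU hU1 hK hβ hβL hM1 h hM2 hβ3 hfloor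
    hcK hc hn2 hn4 htE haS haC hκC hρS hVS hθS hVC hVD hθShalf hθC θ
  refine hmain.trans ?_
  rw [abs_of_pos hβpos]
  have hstep1 : 4 * Real.exp 1 * VD / κC ^ 2 ≤ 4 * 2.72 * (β / N * (β / Real.sqrt M * (1 / (2 : ℝ) ^ 100))) / 12100 :=
    div_le_div₀ (by positivity) (by gcongr) (by norm_num) hκ2
  calc 2 * (N : ℝ) / β * (4 * Real.exp 1 * VD / κC ^ 2)
      ≤ 2 * (N : ℝ) / β * (4 * 2.72 * (β / N * (β / Real.sqrt M * (1 / (2 : ℝ) ^ 100))) / 12100) :=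
        mul_le_mul_of_nonneg_left hstep1 (by positivity)
    _ = (8 * 2.72 / (12100 * (2 : ℝ) ^ 100)) * (β / Real.sqrt M) := by field_simp; ring
    _ ≤ (1 / (2 : ℝ) ^ 60) * (β / Real.sqrt M) := mul_le_mul_of_nonneg_right (by norm_num) hq0
    _ = β / ((2 : ℝ) ^ 60 * Real.sqrt M) := by rw [div_mul_div_comm, one_mul]

end Summit.HubbardSuperconductivity.HubbardSuperconductivity.Theorems.TwoVolumeDefect

end
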